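/-
Copyright (c) 2026 the pub-hodgecm-mathlib formalisation cell (harness21).  Prover seat hodgecm-mathlib-LH4-p11 (g8), Track A «(D-RAM) FOUR-FRAME» squad, helper lane on
h413 = stmt-HodgeConjecture-24833 (count-neutral).  Heir dealer∕pen LH4-plan (g13) WORD #70 (2) ∕ #82 (B); SPEC-B2 v1 3227ed60 (the instantiation inputs of (A_L)).  2026-09-04.
-/
import Summits.HodgeConjecture.HodgeConjecture.Theorems.F0P3cDyRamLabelledOddCountDefs        -- ★ p860257 DEFS leaf (this seat): `IsTorusEquivariantLabel`, `valueClassLabel`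
import Summits.HodgeConjecture.HodgeConjecture.Theorems.F0P3cDyRamDiagonalNormalisedOrbit      -- ★ J′ p855450 (LH4-p08): `mem_mapGL_diagonal_iff`
import HarnessLib

/-!
# Crux `H413`, line LH4 «(D-RAM) FOUR-FRAME» — (B2a-4⁰) «THE VALUE-CLASS LABEL IS TORUS-EQUIVARIANT»: `valueClassLabel σ ϖ x₀ x₁ m d` satisfies `IsTorusEquivariantLabel σ`, and at a
# sign representative `D = d_s` it is the label of ★ p860156's hypothesis `h8` token for token

Cell `hodgecm-mathlib` (D-0151), FLOOR 0, crux item H413 = `stmt-HodgeConjecture-24833`, route `HCCMUnconditional`; squad F0∕P3c∕LH4.  THEOREMS ONLY (no `def`, no instance,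
no notation, no `sorry`, default heartbeats); ★-only imports; lane `--supports stmt-HodgeConjecture-24833 --as helper` (count-neutral); pays NO row, states NO law.

WHY (SPEC-B2 v1 §1 (EQ); the two hypotheses the (A_L) instantiation must discharge).  LH4-p10 (g6)'s (B2a-2) `sum_sign_mul_finsum_ncard_fibre_sepAt_mul_relIndex_eq` takes a pair label
`Λ` with `(hΛ : IsTorusEquivariantLabel σ Λ)`; ★ p860280 (B2a-3) takes a vertex-read family `P e M`.  At the label of record `Λ := valueClassLabel σ ϖ (α−1) (β−1) m* d` these are:
(§1) `hΛ` — the values `D₀x₀N(y₀) + D₁x₁N(y₁)` on `diag(z)·M` are the values `(D₀N(z₀))x₀N(y₀) + (D₁N(z₁))x₁N(y₁)` on `M` (`y = diag(z)y′`, `N(z_jy′_j) = N(z_j)N(y′_j)`; ★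
`mem_mapGL_diagonal_iff`), so the two thickened value sets COINCIDE and the label equation transports; (§2) `P e M = Λ M d_e` is the `h8` label with `d_e j = if e j then u else 1`
substituted (`Iff.rfl`).  Nothing else is in this file.
* §1 `setOf_value_mapGL_diagGLUnits_eq` (the value sets agree), HEAD `isTorusEquivariantLabel_valueClassLabel`.
* §2 `valueClassLabel_signRep_iff` (`Iff.rfl` tie to the `h8` label text).
HONEST LABEL.  Count-neutral; (β-BAL), (A″), (β), T₊ OPEN; `HC_CM` is proved only modulo the 7 printed citations (2 remaining named inputs: hLiu418 = `stmt-HodgeConjecture-24832`,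
h413 = `stmt-HodgeConjecture-24833`) until rung 0 closes.

## References
* [Kottwitz1986BaseChangeUnits] R. E. Kottwitz, *Base change for unit elements of Hecke algebras*, Compositio Math. 60 (1986), §1 pp. 240–241 (the diagonal torus acting on
  lattices and forms).
* [Rogawski1990] J. D. Rogawski, *Automorphic Representations of Unitary Groups in Three Variables*, Ann. of Math. Stud. 123 (1990), §4.9 Prop. 4.9.1 (b) p. 55.
* [Jacobowitz1962] R. Jacobowitz, *Hermitian forms over local fields*, Amer. J. Math. 84 (1962), §4.
-/

set_option autoImplicit false

noncomputable section

namespace Summit.HodgeConjecture.HodgeConjecture.Cruxes.H413.F0P3cDyRamValueClassLabelEquivariant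

open Literature.NumberTheory.Automorphic Literature.NumberTheory.Automorphic.HermitianLattice
open Literature.NumberTheory.Automorphic.UnitaryLatticeTree Literature.NumberTheory.Automorphic.UnitaryThreeFourFrame
open Summit.HodgeConjecture.HodgeConjecture.Cruxes.H413.F0P3cDyRamFourFramePieces
open Summit.HodgeConjecture.HodgeConjecture.Cruxes.H413.F0P3cDyRamDiagonalTorusDefs
open Summit.HodgeConjecture.HodgeConjecture.Cruxes.H413.F0P3cDyRamDiagonalNormalisedOrbit (mem_mapGL_diagonal_iff)
open Summit.HodgeConjecture.HodgeConjecture.Cruxes.H413.F0P3cDyRamLabelledOddCountDefs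
open scoped Valued WithZero Matrix MatrixGroups

variable {K : Type} [Field K] [Valued K ℤᵐ⁰]

/-! ## §1  The value sets of `diag(z)·M` for `D` and of `M` for `D·N(z)` coincide -/

/-- **THE VALUE SETS AGREE**: for every diagonal `z ∈ (K^×)³`, the `ϖ^m`-thickened set of the values `D₀x₀N(y₀) + D₁x₁N(y₁)` over `y ∈ diag(z)·M` is the thickened set of the
values `(D₀N(z₀))x₀N(y₀) + (D₁N(z₁))x₁N(y₁)` over `y ∈ M` (`N(a) = a·σa`; substitute `y = diag(z)y′`). [cite: Kottwitz1986BaseChangeUnits, §1 pp. 240–241] [cite: Jacobowitz1962, §4] -/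
theorem setOf_value_mapGL_diagGLUnits_eq (σ : K →+* K) (ϖ : K) (x₀ x₁ : K) (m : ℕ) (z : Fin 3 → Kˣ) (M : Submodule 𝒪[K] (Fin 3 → K)) (D : Fin 3 → K) :
    {v : K | ∃ y ∈ mapGL (diagGLUnits z) M, Valued.v ((ϖ ^ m)⁻¹ * (v - (D 0 * x₀ * (y 0 * σ (y 0)) + D 1 * x₁ * (y 1 * σ (y 1))))) ≤ 1} =
      {v : K | ∃ y ∈ M, Valued.v ((ϖ ^ m)⁻¹ *
        (v - (D 0 * (((z 0 : Kˣ) : K) * σ ((z 0 : Kˣ) : K)) * x₀ * (y 0 * σ (y 0)) + D 1 * (((z 1 : Kˣ) : K) * σ ((z 1 : Kˣ) : K)) * x₁ * (y 1 * σ (y 1))))) ≤ 1} := by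
  have hz : ∀ i, ((z i : Kˣ) : K) ≠ 0 := fun i => Units.ne_zero _
  ext v
  simp only [Set.mem_setOf_eq]
  constructor
  · rintro ⟨y, hy, hv⟩
    refine ⟨fun i => ((z i : Kˣ) : K)⁻¹ * y i, (mem_mapGL_diagonal_iff (diagGLUnits z) (fun i => ((z i : Kˣ) : K)) (coe_diagGLUnits z) hz M y).1 hy, ?_⟩
    have h0 : D 0 * (((z 0 : Kˣ) : K) * σ ((z 0 : Kˣ) : K)) * x₀ * ((((z 0 : Kˣ) : K)⁻¹ * y 0) * σ (((z 0 : Kˣ) : K)⁻¹ * y 0)) = D 0 * x₀ * (y 0 * σ (y 0)) := by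
      rw [map_mul, map_inv₀]; field_simp
    have h1 : D 1 * (((z 1 : Kˣ) : K) * σ ((z 1 : Kˣ) : K)) * x₁ * ((((z 1 : Kˣ) : K)⁻¹ * y 1) * σ (((z 1 : Kˣ) : K)⁻¹ * y 1)) = D 1 * x₁ * (y 1 * σ (y 1)) := by
      rw [map_mul, map_inv₀]; field_simp
    simp only [h0, h1]
    exact hv
  · rintro ⟨y, hy, hv⟩
    refine ⟨fun i => ((z i : Kˣ) : K) * y i, ?_, ?_⟩
    · rw [mem_mapGL_diagonal_iff (diagGLUnits z) (fun i => ((z i : Kˣ) : K)) (coe_diagGLUnits z) hz M]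
      convert hy using 1
      funext i
      rw [inv_mul_cancel_left₀ (hz i)]
    · have h0 : D 0 * x₀ * ((((z 0 : Kˣ) : K) * y 0) * σ (((z 0 : Kˣ) : K) * y 0)) = D 0 * (((z 0 : Kˣ) : K) * σ ((z 0 : Kˣ) : K)) * x₀ * (y 0 * σ (y 0)) := by
        rw [map_mul]; ring
      have h1 : D 1 * x₁ * ((((z 1 : Kˣ) : K) * y 1) * σ (((z 1 : Kˣ) : K) * y 1)) = D 1 * (((z 1 : Kˣ) : K) * σ ((z 1 : Kˣ) : K)) * x₁ * (y 1 * σ (y 1)) := by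
        rw [map_mul]; ring
      simp only [h0, h1]
      exact hv

/-- **HEAD — THE VALUE-CLASS LABEL OF RECORD IS TORUS-EQUIVARIANT**: `IsTorusEquivariantLabel σ (valueClassLabel σ ϖ x₀ x₁ m d)` — the hypothesis `hΛ` of LH4-p10 (g6)'s (B2a-2) at
the label of ★ p860156's `h8`. [cite: Kottwitz1986BaseChangeUnits, §1 pp. 240–241] [cite: Rogawski1990, §4.9 Prop. 4.9.1 (b) p. 55] -/
theorem isTorusEquivariantLabel_valueClassLabel (σ : K →+* K) (ϖ : K) (x₀ x₁ : K) (m d : ℕ) :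
    IsTorusEquivariantLabel σ (valueClassLabel σ ϖ x₀ x₁ m d) := by
  intro z M D
  unfold valueClassLabel
  rw [setOf_value_mapGL_diagGLUnits_eq σ ϖ x₀ x₁ m z M D]

/-! ## §2  At a sign representative the label is the `h8` label (`Iff.rfl`) -/

/-- At `D = d_s` (`d_s j = u` if `s j` else `1`) the value-class label reads, token for token, as the label of ★ p860156's eightfold hypothesis `h8` (`Iff.rfl`).
[cite: Rogawski1990, §4.9 Prop. 4.9.1 (b) p. 55] -/
theorem valueClassLabel_signRep_iff (σ : K →+* K) (ϖ : K) (x₀ x₁ : K) (m d : ℕ) (u : K) (s : Fin 3 → Bool) (M : Submodule 𝒪[K] (Fin 3 → K)) :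
    valueClassLabel σ ϖ x₀ x₁ m d M (fun j => if s j then u else (1 : K)) ↔
      {v : K | ∃ y ∈ M, Valued.v ((ϖ ^ m)⁻¹ *
          (v - ((if s 0 then u else (1 : K)) * x₀ * (y 0 * σ (y 0)) + (if s 1 then u else (1 : K)) * x₁ * (y 1 * σ (y 1))))) ≤ 1} =
        valueSetMod σ ϖ m (xPlus σ ϖ d) := Iff.rfl

end Summit.HodgeConjecture.HodgeConjecture.Cruxes.H413.F0P3cDyRamValueClassLabelEquivariant

end
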